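import Summits.Ventures.HSemireg.WedgeHankelRecurrencePronyDivisors
import Summits.Ventures.HSemireg.WedgeHankelRecurrenceProny
import Summits.Ventures.HSemireg.WedgeHankelClassMapMatrix

/-!
# Venture HSemireg — THE CLASS MAP READ THROUGH THE RECURRENCES: **a sub-box class `w_k(c)` kills `w_N(q)` iff its twisted polynomial `Σ_r (−1)^r C(k,r) c_{k−r} X^r` lies in
# `Rec_k(q)`** (M7's matrix identity in N18's language), hence — Prony — **it kills a secant class iff the twisted polynomial vanishes at every node, a divisor class iff it vanishes on the
# divisor** (divisible by `Π_i (X − λ_i)^{P_i+1}`): the frame / osculating conditions in coordinates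

HONEST FRAMING. Part of the Lean index of the computation cell `pub-hsemireg` (seat p10 gen 26, Sunday typer «UNIFORM-IN-n»).
LINEAR ALGEBRA OF HANKEL (catalecticant) MATRICES and of polynomials over a field + (through the cited tree theorems) finite-dimensional EXTERIOR ALGEBRA ONLY: no variety, no cohomology
theory, no sheaf, no Ext group and no semiregularity map is constructed here; nothing here says that HC / HC_CM / HC_AV holds; no Literature fact is declared or used.  Custodian versions
as in `WedgeHankelSiegelIdeal` (1/3); the dictionary (`w_k(c)` = a class of the sub-box of the first `k` pairs; the twist `c_{k−r} ↦ (−1)^r C(k,r) c_{k−r}` of I14/M7's apolar pairing) is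
QUOTED, never asserted.

WHAT IS IN THE TREE / KEYED.  M7 (`WedgeHankelClassMapMatrix`, tree) **`w_mul_w_top_eq_zero_iff_vecMul_hankel1`** (`w_k(c) ∧ w_N(q) = 0 ↔` the twisted window lies in the left kernel of
`H_k(q)`); N18 (№ 173) `mem_recSpace_iff_vecMul_eq_zero`; N19 (№ 174) `mem_recSpace_secSeq_iff` (Prony); N20 (№ 181) `mem_recSpace_divisor_iff_dvd`, `recSpace_divisor_eq_bot`.
THIS FILE (namespace `Summit.Ventures.HSemireg.Wedge.HankelOuter` continued; CHAINED on N19 and N20; 1 definition `hankelTwistPoly`):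
* §498 `hankelTwistPoly k c := Σ_{r ≤ k} (−1)^r C(k,r) c_{k−r} X^r` (`hankelTwistPoly_mem_degreeLT`, `degreeLTEquiv_hankelTwistPoly`, `coeff_hankelTwistPoly`); **`w_mul_w_eq_zero_iff_hankelTwistPoly_mem_recSpace`**
  (`k ≤ N`: `w_k(c) ∧ w_N(q) = 0 ↔ hankelTwistPoly k c ∈ Rec_k(q)`), `w_mul_w_eq_zero_mono_of_recSpace_le`.
* §499 PRONY ON THE CLASS SIDE: **`w_mul_w_secSeq_eq_zero_iff`** (distinct nodes, non-zero weights, `r + k ≤ N + 1`: `w_k(c) ∧ w_N(secSeq A λ) = 0 ↔ ∀ i, (hankelTwistPoly k c)(λ_i) = 0`),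
  **`w_mul_w_divisor_eq_zero_iff`** (distinct nodes, exact orders, `D + k ≤ N + 1`: `↔ Π_i (X − λ_i)^{P_i+1} ∣ hankelTwistPoly k c`), `hankelTwistPoly_eq_zero_of_w_mul_w_divisor_eq_zero` (`k < D`: only the
  untwisted-zero class kills).
READING: D2/G3's frame ideals and N4/N7's osculating flats described WHICH FORMS kill the node / divisor classes inside the exterior algebra; restricted to the `(k+1)`-dimensional space of
sub-box classes `w_k(c)` the answer is one line of polynomial algebra — vanish on the divisor after M7's twist.  Nothing Ext-side.  New names only.
-/

open Module Polynomial
open scoped Matrix Polynomial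

namespace Summit.Ventures.HSemireg.Wedge.HankelOuter

open Summit.Ventures.HSemireg.Wedge Summit.Ventures.HSemireg.Wedge.Kunneth Summit.Ventures.HSemireg.Wedge.Hankel
  Summit.Ventures.HSemireg.Wedge.HankelSecant Summit.Ventures.HSemireg.Wedge.HankelFrameChange

variable (K : Type*) [Field K] {N : ℕ}

/-! ## §498. A sub-box class kills the class iff its twisted polynomial is a recurrence -/

/-- THE TWISTED POLYNOMIAL of a sub-box class `w_k(c)`: `Σ_{r ≤ k} (−1)^r C(k,r) c_{k−r} X^r` (M7's twist of the coefficient window, read as a polynomial of degree `≤ k`). -/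
noncomputable def hankelTwistPoly (k : ℕ) (c : ℕ → K) : K[X] :=
  ((Polynomial.degreeLTEquiv K (k + 1)).symm fun r : Fin (k + 1) => (-1) ^ (r : ℕ) * (k.choose (r : ℕ) : K) * c (k - (r : ℕ)) : Polynomial.degreeLT K (k + 1))

/-- `hankelTwistPoly k c` has degree `≤ k`. -/
theorem hankelTwistPoly_mem_degreeLT (k : ℕ) (c : ℕ → K) : hankelTwistPoly K k c ∈ Polynomial.degreeLT K (k + 1) :=
  ((Polynomial.degreeLTEquiv K (k + 1)).symm _).2

/-- its coefficient vector is M7's twisted window. -/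
theorem degreeLTEquiv_hankelTwistPoly (k : ℕ) (c : ℕ → K) :
    Polynomial.degreeLTEquiv K (k + 1) ⟨hankelTwistPoly K k c, hankelTwistPoly_mem_degreeLT K k c⟩
      = fun r : Fin (k + 1) => (-1) ^ (r : ℕ) * (k.choose (r : ℕ) : K) * c (k - (r : ℕ)) := by
  exact (Polynomial.degreeLTEquiv K (k + 1)).apply_symm_apply _

/-- its coefficients. -/
theorem coeff_hankelTwistPoly (k : ℕ) (c : ℕ → K) (r : Fin (k + 1)) : (hankelTwistPoly K k c).coeff r = (-1) ^ (r : ℕ) * (k.choose (r : ℕ) : K) * c (k - (r : ℕ)) := by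
  have := congrFun (degreeLTEquiv_hankelTwistPoly K k c) r
  exact this

/-- **A SUB-BOX CLASS KILLS THE CLASS IFF ITS TWISTED POLYNOMIAL IS A RECURRENCE: `w_k(c) ∧ w_N(q) = 0 ↔ hankelTwistPoly k c ∈ Rec_k(q)`** (`k ≤ N`, every field; M7's matrix identity
read in N18's language). -/
theorem w_mul_w_eq_zero_iff_hankelTwistPoly_mem_recSpace {k : ℕ} (hk : k ≤ N) (c q : ℕ → K) :
    w K N k c * w K N N q = 0 ↔ hankelTwistPoly K k c ∈ recSpace K N q k := by
  rw [w_mul_w_top_eq_zero_iff_vecMul_hankel1 K hk c q,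
    mem_recSpace_iff_vecMul_eq_zero K q ⟨hankelTwistPoly K k c, hankelTwistPoly_mem_degreeLT K k c⟩, degreeLTEquiv_hankelTwistPoly]

/-- hence **the sub-box classes of degree `k` killing `w_N(q)` and those killing `w_N(q′)` compare as `Rec_k(q)` and `Rec_k(q′)` do**: `Rec_k(q) ⊆ Rec_k(q′) ⇒` every `w_k(c)`
killing `w_N(q)` kills `w_N(q′)`. -/
theorem w_mul_w_eq_zero_mono_of_recSpace_le {k : ℕ} (hk : k ≤ N) {q q' : ℕ → K} (h : recSpace K N q k ≤ recSpace K N q' k) {c : ℕ → K}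
    (hc : w K N k c * w K N N q = 0) : w K N k c * w K N N q' = 0 :=
  (w_mul_w_eq_zero_iff_hankelTwistPoly_mem_recSpace K hk c q').mpr (h ((w_mul_w_eq_zero_iff_hankelTwistPoly_mem_recSpace K hk c q).mp hc))

/-! ## §499. Prony on the class side: a sub-box class kills a secant / divisor class iff its twisted polynomial vanishes on the divisor -/

/-- **`w_k(c) ∧ w_N(Σ_i A_i λ_i^•) = 0 ↔ (hankelTwistPoly k c)(λ_i) = 0` for all `i`** (distinct nodes, non-zero weights, `r + k ≤ N + 1`, `k ≤ N`): a sub-box class kills the secant class iff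
its twisted polynomial VANISHES AT EVERY NODE (the frame conditions in coordinates). -/
theorem w_mul_w_secSeq_eq_zero_iff {k : ℕ} (hk : k ≤ N) {r : ℕ} {A lam : Fin r → K} (hA : ∀ i, A i ≠ 0) (hlam : Function.Injective lam) (hrk : r + k ≤ N + 1)
    (c : ℕ → K) : w K N k c * w K N N (secSeq K A lam) = 0 ↔ ∀ i, (hankelTwistPoly K k c).eval (lam i) = 0 := by
  rw [w_mul_w_eq_zero_iff_hankelTwistPoly_mem_recSpace K hk, mem_recSpace_secSeq_iff K hA hlam hrk]
  exact ⟨fun h => h.2, fun h => ⟨hankelTwistPoly_mem_degreeLT K k c, h⟩⟩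

/-- **`w_k(c) ∧ w_N(Σ_i expMul λ_i q_i) = 0 ↔ Π_i (X − λ_i)^{P_i+1} ∣ hankelTwistPoly k c`** (distinct nodes, exact orders `P_i`, `D + k ≤ N + 1`, `k ≤ N`): a sub-box class kills the divisor class
iff its twisted polynomial vanishes on the DIVISOR (to order `P_i + 1` at `λ_i`) — the osculating conditions in coordinates. -/
theorem w_mul_w_divisor_eq_zero_iff {k : ℕ} (hk : k ≤ N) {r : ℕ} {lam : Fin r → K} (hlam : Function.Injective lam) {P : Fin r → ℕ} {q : Fin r → ℕ → K}
    (hq : ∀ i j, P i < j → q i j = 0) (hqP : ∀ i, q i (P i) ≠ 0) (hDk : (∑ i, (P i + 1)) + k ≤ N + 1) (c : ℕ → K) :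
    w K N k c * w K N N (fun j => ∑ i, expMul K (lam i) (q i) j) = 0 ↔ (∏ i, (Polynomial.X - Polynomial.C (lam i)) ^ (P i + 1)) ∣ hankelTwistPoly K k c := by
  rw [w_mul_w_eq_zero_iff_hankelTwistPoly_mem_recSpace K hk, mem_recSpace_divisor_iff_dvd K hlam hq hqP hDk]
  exact ⟨fun h => h.2, fun h => ⟨hankelTwistPoly_mem_degreeLT K k c, h⟩⟩

/-- in particular NO non-trivially-twisted sub-box class of degree `k < D` kills the divisor class: `w_k(c) ∧ w_N(Σ expMul λ_i q_i) = 0 ⇒ hankelTwistPoly k c = 0` (`k < D`, `D + k ≤ N + 1`). -/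
theorem hankelTwistPoly_eq_zero_of_w_mul_w_divisor_eq_zero {k : ℕ} (hk : k ≤ N) {r : ℕ} {lam : Fin r → K} (hlam : Function.Injective lam) {P : Fin r → ℕ} {q : Fin r → ℕ → K}
    (hq : ∀ i j, P i < j → q i j = 0) (hqP : ∀ i, q i (P i) ≠ 0) {c : ℕ → K} (hkD : k < ∑ i, (P i + 1)) (hDk : (∑ i, (P i + 1)) + k ≤ N + 1)
    (h : w K N k c * w K N N (fun j => ∑ i, expMul K (lam i) (q i) j) = 0) : hankelTwistPoly K k c = 0 := by
  have hmem := (w_mul_w_eq_zero_iff_hankelTwistPoly_mem_recSpace K hk c _).mp h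
  rw [recSpace_divisor_eq_bot K hlam hq hqP hkD hDk, Submodule.mem_bot] at hmem
  exact hmem

end Summit.Ventures.HSemireg.Wedge.HankelOuter
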